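import Mathlib.Analysis.Normed.Module.Connected
import Mathlib.Analysis.Meromorphic.Order
import Literature.NumberTheory.EllipticCurves.Uniformization
import HarnessLib

/-!
# Proof of the Uniformization Theorem (uniqueness half, Silverman AEC VI.5.1)

Discharge `PeriodPair.uniformization_unique_holds` of the named fact
`PeriodPair.uniformization_unique` of `Literature/NumberTheory/EllipticCurves/Uniformization.lean`
(D-0014 sibling `…Proofs` file): two period pairs with the same invariants `g₂, g₃` span the same
lattice.

Classical proof (Silverman AEC VI.3.5.1 / Apostol, *Modular Functions and Dirichlet Series*,
Thm. 1.13): the Laurent coefficients of `℘_Λ` at `0` are polynomials in `g₂, g₃`, so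
`℘_Λ = ℘_{Λ'}` near `0`, hence everywhere, and `Λ` is the set of poles of `℘_Λ`.  We replace the
coefficient recurrence by a leading-term argument that only uses Mathlib's differential equation
`PeriodPair.derivWeierstrassP_sq` (`℘'² = 4℘³ − g₂℘ − g₃`) and the analytic parts
`u = ℘[L - (0 : ℂ)] = ℘ − z⁻²`, `v = ℘'[L - (0 : ℂ)] = ℘' + 2z⁻³` at `0`:

1. `weierstrassPExcept_eventuallyEq` : if `g₂(Λ₁) = g₂(Λ₂)`, `g₃(Λ₁) = g₃(Λ₂)` then `u₁ = u₂`
   near `0`.  Otherwise `u₁ − u₂ = zⁿ g`, `g(0) ≠ 0`, `n ≥ 1`; with `Pᵢ = z²℘ᵢ = z²uᵢ + 1`,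
   `Qᵢ = z³℘ᵢ' = z³vᵢ − 2` the two differential equations give
   `(Q₁ − Q₂)(Q₁ + Q₂) = (P₁ − P₂)(4(P₁² + P₁P₂ + P₂²) − g₂z⁴)`, i.e. after cancelling `zⁿ⁺²`,
   `(n g + z g')(Q₁ + Q₂) = g · (4(P₁² + P₁P₂ + P₂²) − g₂z⁴)`; at `z = 0` this reads
   `−4n·g(0) = 12·g(0)`, absurd.
2. `lattice_eq_of_weierstrassPExcept_eventuallyEq` : then `℘₁ = ℘₂` on the connected open set
   `ℂ ∖ (Λ₁ ∪ Λ₂)` (identity theorem), so `℘₁, ℘₂` have the same germs on every punctured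
   neighbourhood; since `℘_Λ` has meromorphic order `−2` exactly at the points of `Λ`
   (`PeriodPair.order_weierstrassP`) and is analytic elsewhere, `Λ₁ = Λ₂`.

## References

* J. H. Silverman, *The Arithmetic of Elliptic Curves*, 2nd ed., GTM 106, Springer 2009,
  Thm. VI.5.1 (uniqueness), Thm. VI.3.5.
* T. M. Apostol, *Modular Functions and Dirichlet Series in Number Theory*, 2nd ed., Thm. 1.13.
-/

noncomputable section

open scoped Topology
open Filter Set Complex

namespace PeriodPair

/-! ### Local pieces at the origin -/

/-- The lattice of a period pair is countable. [folklore] -/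
lemma countable_lattice (L : PeriodPair) : (L.lattice : Set ℂ).Countable :=
  countable_of_Lindelof_of_discrete (X := L.lattice)

/-- `℘(z) = ℘[L - (0 : ℂ)](z) + z⁻²`. [folklore] -/
lemma weierstrassP_eq_weierstrassPExcept_add (L : PeriodPair) (z : ℂ) :
    ℘[L] z = ℘[L - (0 : ℂ)] z + 1 / z ^ 2 := by
  have := L.weierstrassPExcept_add ⟨0, zero_mem _⟩ z
  simp only [sub_zero, ne_eq, OfNat.ofNat_ne_zero, not_false_eq_true, zero_pow, div_zero] at this
  rw [← this]

/-- `℘'(z) = ℘'[L - (0 : ℂ)](z) − 2z⁻³`. [folklore] -/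
lemma derivWeierstrassP_eq_derivWeierstrassPExcept_sub (L : PeriodPair) (z : ℂ) :
    ℘'[L] z = ℘'[L - (0 : ℂ)] z - 2 / z ^ 3 := by
  have := L.derivWeierstrassPExcept_sub ⟨0, zero_mem _⟩ z
  simp only [sub_zero] at this
  rw [← this]

/-- `deriv ℘[L - (0 : ℂ)] = ℘'[L - (0 : ℂ)]` near `0`. [folklore] -/
lemma deriv_weierstrassPExcept_eventuallyEq (L : PeriodPair) :
    deriv ℘[L - (0 : ℂ)] =ᶠ[𝓝 0] ℘'[L - (0 : ℂ)] := by
  filter_upwards [L.compl_lattice_sdiff_singleton_mem_nhds 0] with z hz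
  exact L.eqOn_deriv_weierstrassPExcept_derivWeierstrassPExcept 0 hz

/-- Nonzero points near `0` are not lattice points. [folklore] -/
lemma eventually_nhdsNE_notMem_lattice (L : PeriodPair) : ∀ᶠ z in 𝓝[≠] (0 : ℂ), z ∉ L.lattice := by
  have h1 : ∀ᶠ z in 𝓝[≠] (0 : ℂ), z ∈ (L.lattice \ {(0 : ℂ)} : Set ℂ)ᶜ :=
    mem_nhdsWithin_of_mem_nhds (L.compl_lattice_sdiff_singleton_mem_nhds 0)
  filter_upwards [h1, self_mem_nhdsWithin] with z hz hz0
  simp only [mem_compl_iff, Set.mem_sdiff, SetLike.mem_coe, mem_singleton_iff, not_and,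
    not_not] at hz
  exact fun h ↦ hz0 (hz h)

/-! ### Step 1: equal invariants force equal germs at the origin -/

/-- **Local uniqueness.**  Two lattices with the same invariants `g₂, g₃` have the same analytic
part `℘ − z⁻²` near `0` (leading-term argument on the difference of the two differential
equations `℘'² = 4℘³ − g₂℘ − g₃`; Silverman AEC VI.5.1 uniqueness / Apostol Thm. 1.13).
[cite: SilvermanAEC2009, Thm VI.5.1 (uniqueness)] -/
theorem weierstrassPExcept_eventuallyEq {L₁ L₂ : PeriodPair} (h₂ : L₁.g₂ = L₂.g₂)
    (h₃ : L₁.g₃ = L₂.g₃) : ℘[L₁ - (0 : ℂ)] =ᶠ[𝓝 0] ℘[L₂ - (0 : ℂ)] := by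
  set u₁ := ℘[L₁ - (0 : ℂ)] with hu₁
  set u₂ := ℘[L₂ - (0 : ℂ)] with hu₂
  set v₁ := ℘'[L₁ - (0 : ℂ)] with hv₁
  set v₂ := ℘'[L₂ - (0 : ℂ)] with hv₂
  have hu₁a : AnalyticAt ℂ u₁ 0 := L₁.analyticAt_weierstrassPExcept 0
  have hu₂a : AnalyticAt ℂ u₂ 0 := L₂.analyticAt_weierstrassPExcept 0
  have hv₁a : AnalyticAt ℂ v₁ 0 := L₁.analyticAt_derivWeierstrassPExcept 0
  have hv₂a : AnalyticAt ℂ v₂ 0 := L₂.analyticAt_derivWeierstrassPExcept 0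
  -- the difference `d = u₁ - u₂`
  set d : ℂ → ℂ := fun z ↦ u₁ z - u₂ z with hd
  have hda : AnalyticAt ℂ d 0 := hu₁a.sub hu₂a
  have hd0 : d 0 = 0 := by simp [hd, hu₁, hu₂]
  suffices htop : analyticOrderAt d 0 = ⊤ by
    rw [analyticOrderAt_eq_top] at htop
    filter_upwards [htop] with z hz
    exact sub_eq_zero.mp hz
  by_contra hne
  obtain ⟨n, hn⟩ := ENat.ne_top_iff_exists.mp hne
  obtain ⟨g, hga, hg0, hdg⟩ := hda.analyticOrderAt_eq_natCast.mp hn.symm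
  simp only [sub_zero, smul_eq_mul] at hdg
  -- `n = m + 1` since `d 0 = 0`
  obtain ⟨m, rfl⟩ : ∃ m, n = m + 1 := by
    refine Nat.exists_eq_add_one.mpr (Nat.pos_of_ne_zero ?_)
    rintro rfl
    have h := hdg.self_of_nhds
    rw [hd0, pow_zero, one_mul] at h
    exact hg0 h.symm
  -- derivative of `d`: `v₁ - v₂ = (m+1) zᵐ g + z^{m+1} g'` near `0`
  have hdd : deriv d =ᶠ[𝓝 0] fun z ↦ v₁ z - v₂ z := by
    filter_upwards [hu₁a.eventually_analyticAt, hu₂a.eventually_analyticAt,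
      L₁.deriv_weierstrassPExcept_eventuallyEq, L₂.deriv_weierstrassPExcept_eventuallyEq]
      with z h1 h2 h3 h4
    rw [show d = u₁ - u₂ from rfl, deriv_sub h1.differentiableAt h2.differentiableAt, h3, h4]
  have hdd' : deriv d =ᶠ[𝓝 0] fun z ↦ (m + 1 : ℕ) * z ^ m * g z + z ^ (m + 1) * deriv g z := by
    have h1 : deriv d =ᶠ[𝓝 0] deriv (fun z ↦ z ^ (m + 1) * g z) :=
      (show d =ᶠ[𝓝 0] fun z ↦ z ^ (m + 1) * g z from hdg).deriv
    filter_upwards [h1, hga.eventually_analyticAt] with z hz hgz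
    rw [hz, deriv_fun_mul (differentiableAt_pow _) hgz.differentiableAt, deriv_pow_field]
    simp
  have hδ : ∀ᶠ z in 𝓝 0, v₁ z - v₂ z = (m + 1 : ℕ) * z ^ m * g z + z ^ (m + 1) * deriv g z := by
    filter_upwards [hdd, hdd'] with z h1 h2
    rw [← h1, h2]
  -- the two continuous functions that agree on a punctured neighbourhood of `0`
  set F : ℂ → ℂ := fun z ↦ ((m + 1 : ℕ) * g z + z * deriv g z) *
    ((z ^ 3 * v₁ z - 2) + (z ^ 3 * v₂ z - 2)) with hF
  set G : ℂ → ℂ := fun z ↦ g z * (4 * ((z ^ 2 * u₁ z + 1) ^ 2 +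
    (z ^ 2 * u₁ z + 1) * (z ^ 2 * u₂ z + 1) + (z ^ 2 * u₂ z + 1) ^ 2) - L₁.g₂ * z ^ 4) with hG
  have hFG : F =ᶠ[𝓝[≠] 0] G := by
    filter_upwards [L₁.eventually_nhdsNE_notMem_lattice, L₂.eventually_nhdsNE_notMem_lattice,
      self_mem_nhdsWithin, mem_nhdsWithin_of_mem_nhds hdg, mem_nhdsWithin_of_mem_nhds hδ]
      with z hz₁ hz₂ hz0 hdz hδz
    replace hz0 : z ≠ 0 := hz0
    -- `Pᵢ = z² ℘ᵢ`, `Qᵢ = z³ ℘ᵢ'`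
    have hP₁ : z ^ 2 * ℘[L₁] z = z ^ 2 * u₁ z + 1 := by
      rw [L₁.weierstrassP_eq_weierstrassPExcept_add, ← hu₁]; field_simp
    have hP₂ : z ^ 2 * ℘[L₂] z = z ^ 2 * u₂ z + 1 := by
      rw [L₂.weierstrassP_eq_weierstrassPExcept_add, ← hu₂]; field_simp
    have hQ₁ : z ^ 3 * ℘'[L₁] z = z ^ 3 * v₁ z - 2 := by
      rw [L₁.derivWeierstrassP_eq_derivWeierstrassPExcept_sub, ← hv₁]; field_simp
    have hQ₂ : z ^ 3 * ℘'[L₂] z = z ^ 3 * v₂ z - 2 := by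
      rw [L₂.derivWeierstrassP_eq_derivWeierstrassPExcept_sub, ← hv₂]; field_simp
    set P₁ := z ^ 2 * u₁ z + 1 with hP₁_def
    set P₂ := z ^ 2 * u₂ z + 1 with hP₂_def
    set Q₁ := z ^ 3 * v₁ z - 2 with hQ₁_def
    set Q₂ := z ^ 3 * v₂ z - 2 with hQ₂_def
    -- the differential equations, multiplied by `z⁶`
    have rel₁ : Q₁ ^ 2 = 4 * P₁ ^ 3 - L₁.g₂ * z ^ 4 * P₁ - L₁.g₃ * z ^ 6 := by
      rw [← hP₁, ← hQ₁]
      linear_combination z ^ 6 * L₁.derivWeierstrassP_sq z hz₁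
    have rel₂ : Q₂ ^ 2 = 4 * P₂ ^ 3 - L₁.g₂ * z ^ 4 * P₂ - L₁.g₃ * z ^ 6 := by
      rw [← hP₂, ← hQ₂, h₂, h₃]
      linear_combination z ^ 6 * L₂.derivWeierstrassP_sq z hz₂
    have hdP : P₁ - P₂ = z ^ (m + 3) * g z := by
      rw [hP₁_def, hP₂_def]
      linear_combination z ^ 2 * hdz
    have hdQ : Q₁ - Q₂ = z ^ (m + 3) * ((m + 1 : ℕ) * g z + z * deriv g z) := by
      rw [hQ₁_def, hQ₂_def]
      linear_combination z ^ 3 * hδz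
    have key : z ^ (m + 3) * F z = z ^ (m + 3) * G z := by
      simp only [hF, hG]
      linear_combination -(Q₁ + Q₂) * hdQ +
        (4 * (P₁ ^ 2 + P₁ * P₂ + P₂ ^ 2) - L₁.g₂ * z ^ 4) * hdP + rel₁ - rel₂
    exact mul_left_cancel₀ (pow_ne_zero _ hz0) key
  -- both sides are continuous at `0`, so they agree at `0`: `-4(m+1) g(0) = 12 g(0)`
  have hgc : ContinuousAt g 0 := hga.continuousAt
  have hg'c : ContinuousAt (deriv g) 0 := hga.deriv.continuousAt
  have hFc : ContinuousAt F 0 := by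
    have := hv₁a.continuousAt; have := hv₂a.continuousAt
    simp only [hF]
    fun_prop
  have hGc : ContinuousAt G 0 := by
    have := hu₁a.continuousAt; have := hu₂a.continuousAt
    simp only [hG]
    fun_prop
  have hlim : F 0 = G 0 :=
    tendsto_nhds_unique_of_eventuallyEq (hFc.tendsto.mono_left nhdsWithin_le_nhds)
      (hGc.tendsto.mono_left nhdsWithin_le_nhds) hFG
  simp only [hF, hG] at hlim
  norm_num at hlim
  -- `hlim : (m+1) g 0 * (-4) = g 0 * 12` up to normalisation
  have : ((m + 1 : ℕ) : ℂ) * 4 + 12 ≠ 0 := by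
    norm_cast
  apply hg0
  have h4 : (((m + 1 : ℕ) : ℂ) * 4 + 12) * g 0 = 0 := by
    push_cast at hlim ⊢
    linear_combination -hlim
  exact (mul_eq_zero.mp h4).resolve_left this

/-! ### Step 2: equal germs at the origin force equal lattices -/

/-- If `℘_{Λ₁} − z⁻²` and `℘_{Λ₂} − z⁻²` agree near `0`, then `℘_{Λ₁} = ℘_{Λ₂}` off `Λ₁ ∪ Λ₂`
(identity theorem on the connected open set `ℂ ∖ (Λ₁ ∪ Λ₂)`). [folklore] -/
theorem weierstrassP_eqOn_of_weierstrassPExcept_eventuallyEq {L₁ L₂ : PeriodPair}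
    (h : ℘[L₁ - (0 : ℂ)] =ᶠ[𝓝 0] ℘[L₂ - (0 : ℂ)]) :
    EqOn ℘[L₁] ℘[L₂] ((L₁.lattice : Set ℂ) ∪ L₂.lattice)ᶜ := by
  -- a base point `z₀` near `0`
  have hW : ∀ᶠ z in 𝓝[≠] (0 : ℂ), ℘[L₁] z = ℘[L₂] z ∧ z ∉ L₁.lattice ∧ z ∉ L₂.lattice := by
    filter_upwards [mem_nhdsWithin_of_mem_nhds h, L₁.eventually_nhdsNE_notMem_lattice,
      L₂.eventually_nhdsNE_notMem_lattice] with z hz h1 h2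
    exact ⟨by rw [L₁.weierstrassP_eq_weierstrassPExcept_add,
      L₂.weierstrassP_eq_weierstrassPExcept_add, hz], h1, h2⟩
  rw [eventually_nhdsWithin_iff, Metric.eventually_nhds_iff] at hW
  obtain ⟨r, hr, hW⟩ := hW
  set z₀ : ℂ := ((r / 2 : ℝ) : ℂ) with hz₀
  have hz₀0 : z₀ ≠ 0 := by
    rw [hz₀]; exact_mod_cast (by positivity : (r / 2 : ℝ) ≠ 0)
  have hz₀r : dist z₀ 0 < r := by
    rw [hz₀, dist_zero_right, Complex.norm_real, Real.norm_eq_abs, abs_of_pos (by positivity)]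
    linarith
  obtain ⟨_, hz₀1, hz₀2⟩ := hW hz₀r hz₀0
  have hev : ℘[L₁] =ᶠ[𝓝 z₀] ℘[L₂] := by
    have : Metric.ball (0 : ℂ) r ∩ {(0 : ℂ)}ᶜ ∈ 𝓝 z₀ :=
      (Metric.isOpen_ball.inter isOpen_compl_singleton).mem_nhds ⟨hz₀r, hz₀0⟩
    filter_upwards [this] with z hz
    exact (hW hz.1 hz.2).1
  -- identity theorem
  have hconn : IsPreconnected ((L₁.lattice : Set ℂ) ∪ L₂.lattice)ᶜ :=
    (Set.Countable.isConnected_compl_of_one_lt_rank (by simp)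
      (L₁.countable_lattice.union L₂.countable_lattice)).isPreconnected
  refine AnalyticOnNhd.eqOn_of_preconnected_of_eventuallyEq
    (L₁.analyticOnNhd_weierstrassP.mono ?_) (L₂.analyticOnNhd_weierstrassP.mono ?_) hconn
    (z₀ := z₀) (by simp [hz₀1, hz₀2]) hev
  · exact compl_subset_compl.mpr subset_union_left
  · exact compl_subset_compl.mpr subset_union_right

/-- If `℘_{Λ₁} = ℘_{Λ₂}` off `Λ₁ ∪ Λ₂`, the two functions have the same germ on every punctured
neighbourhood. [folklore] -/
lemma weierstrassP_eventuallyEq_nhdsNE {L₁ L₂ : PeriodPair}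
    (h : EqOn ℘[L₁] ℘[L₂] ((L₁.lattice : Set ℂ) ∪ L₂.lattice)ᶜ) (x : ℂ) :
    ℘[L₁] =ᶠ[𝓝[≠] x] ℘[L₂] := by
  have hcl : IsClosed (((L₁.lattice : Set ℂ) \ {x}) ∪ ((L₂.lattice : Set ℂ) \ {x})) :=
    (L₁.isClosed_of_subset_lattice Set.sdiff_subset).union
      (L₂.isClosed_of_subset_lattice Set.sdiff_subset)
  have hx : x ∈ (((L₁.lattice : Set ℂ) \ {x}) ∪ ((L₂.lattice : Set ℂ) \ {x}))ᶜ := by simp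
  rw [EventuallyEq, eventually_nhdsWithin_iff]
  filter_upwards [hcl.isOpen_compl.mem_nhds hx] with z hz hzx
  apply h
  simp only [mem_compl_iff, mem_union, Set.mem_sdiff, SetLike.mem_coe, mem_singleton_iff, not_or,
    not_and, not_not] at hz ⊢
  exact ⟨fun h1 ↦ hzx (hz.1 h1), fun h2 ↦ hzx (hz.2 h2)⟩

/-- **From germs to lattices.**  If `℘_{Λ₁} − z⁻² = ℘_{Λ₂} − z⁻²` near `0` then `Λ₁ = Λ₂`: the
lattice is the set of points where `℘` has meromorphic order `−2` (Mathlib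
`PeriodPair.order_weierstrassP`), `℘` being analytic elsewhere. [folklore] -/
theorem lattice_eq_of_weierstrassPExcept_eventuallyEq {L₁ L₂ : PeriodPair}
    (h : ℘[L₁ - (0 : ℂ)] =ᶠ[𝓝 0] ℘[L₂ - (0 : ℂ)]) : L₁.lattice = L₂.lattice := by
  have heq := weierstrassP_eqOn_of_weierstrassPExcept_eventuallyEq h
  have key : ∀ {M₁ M₂ : PeriodPair}, EqOn ℘[M₁] ℘[M₂] ((M₁.lattice : Set ℂ) ∪ M₂.lattice)ᶜ →
      M₁.lattice ≤ M₂.lattice := by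
    intro M₁ M₂ hM x hx
    by_contra hx2
    have h1 : meromorphicOrderAt ℘[M₁] x = -2 := M₁.order_weierstrassP x hx
    have h2 : meromorphicOrderAt ℘[M₂] x = -2 := by
      rw [← meromorphicOrderAt_congr (weierstrassP_eventuallyEq_nhdsNE hM x), h1]
    have h3 : 0 ≤ meromorphicOrderAt ℘[M₂] x :=
      (M₂.analyticOnNhd_weierstrassP x hx2).meromorphicOrderAt_nonneg
    rw [h2] at h3
    exact absurd h3 (by decide)
  refine le_antisymm (key heq) (key ?_)
  rw [union_comm]
  exact heq.symm

/-! ### The Uniformization Theorem, uniqueness -/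

/-- **The Uniformization Theorem, uniqueness** (Silverman AEC VI.5.1): discharge of the named
fact `PeriodPair.uniformization_unique` — two period pairs with the same invariants `g₂, g₃` span
the same lattice.
[cite: SilvermanAEC2009, Thm VI.5.1 (uniqueness)] -/
theorem uniformization_unique_holds : uniformization_unique :=
  fun _ _ h₂ h₃ ↦ lattice_eq_of_weierstrassPExcept_eventuallyEq
    (weierstrassPExcept_eventuallyEq h₂ h₃)

end PeriodPair

end
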